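import Literature.MathematicalPhysics.QuantumFieldTheory.Balaban1983to89.T4HistoryLipschitzOuter

/-!
# NE9TableSlotChartWitness — the TABLE SLOT of the step of record is BACKGROUND-BLIND: a (1.33)-shaped step («old action at the
# displaced background minus at the background») factorises through the truncated full table read OFF the background, and through
# NO reading of the table AT the background — kernel witness of the owner's located finding OBJ-NE9-g31-1
# (cell `pub-balaban`, T4-DAG §2 node U3 ∕ §6 NE9; BINDER row NE9 OWNER lineage `b2b-balaban-t4-ne9-p1`, generation 31; sheet
# `t4/b2b-balaban-t4-ne9-p1/g31/D8-ANSWER-NE9-g31.md` §2)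

HONEST FRAMING (T4-DAG PAGE 1).  Rung (B)+1 of the FINITE-VOLUME T⁴ programme — NOT infinite volume, NOT a mass gap, NOT the
Clay problem.  NE9 (`T4OutputRate.NE9` ∧ `FadingMemory`) is a cell NEW ESTIMATE, NOT PRINTED, NOT PROVED for Bałaban's E^{(j)};
0∕18 leaves instantiated on Bałaban's objects; spine PROVED 0∕9.  HONEST DEPENDENCY (cell line, verbatim): continuum YM on T⁴ ⇐
BetaPertH ∧ nine spine estimates (0/9 proved); BetaPertH ⇐ (D1) ∧ (D4) ∧ CAP+tail; G-an2-4 gates asym, D1 and NE2/3/4.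
`FlowStep.BetaPertH`, (B), (B^μ) do not occur.  [II] = [Balaban1988RG2Cluster] (CMP **116**) is quoted for TYPES only (ABSOLUTE RULE:
nothing printed in the audited series is asserted).  No `def … : Prop`; a TOY on a three-domain carrier; 0 sorry.

THE FINDING THIS TOY MAKES KERNEL-VISIBLE (OBJ-NE9-g31-1, owner gen 31).  The step of record's HISTORY enters the new term ONLY
through the TABLE `T4InputCauchyRateData.tableB EB g U = fun Y => EB g U Y` — the earlier terms AT THE SAME BACKGROUND `U` —
inserted affinely (`B13HistInsertion.InsDatum.insB g U k t = base + Σ_j ω^{k−1−j} • slice k j (insOpB g U k) t`), with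
`insOpB g U k = iop (g (k−1)) U k` reading only the LAST coupling (S-U3 `SubstrateSlotsOfRecord.insDatumOfRecord`, [dict] D-6′ —
this lineage's own request OBJ-NE9-g28-1); accordingly the NE9 faces of record (`U3PolymerDictionaryNE9Face.factorises_outB_KP_of_dataFactor`
p218863, `SubstrateSlotsOfRecord.factorises_outB_KP_slotsOfRecord` p220104) inhabit `T4HistoryLipschitzOuter.Factorises` with the
FULL-table channel `fun _ _ H p => H p.1 p.2` and a new-term map READING THE TABLE AT `U` ONLY: `fun k s Q U X => … (fun Y => Q (U, Y))`.
Print, [II] Lemma 1 (1.33) p. 9: *"E_k(U_k(exp iB′V^{(k)})) − E_k(U_k(V^{(k)})) = Σ_{Y∈D_k} 𝐕′_k(Y, U_{k+1}, B)"* and (1.23) p. 7 (the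
pieces are Taylor remainders of the EARLIER terms along the fluctuation curves, *"we represent all derivatives by the Cauchy
formula"*): the inserted history reads the earlier terms as FUNCTIONS OF THE CONFIGURATION near the background (on the complex
space (1.34)), NOT their values at the background.  THE TOY (§1): three domains `0, 1, 2` of creation steps 0, 1, 2, background
`U : ℝ`; `Ebal g U 1 = g 0 · U` (a scale-1 term, created with last coupling `g 0`), `Ebal g U 2 = Ebal g (U+1) 1 − Ebal g U 1`
(a scale-2 term of the (1.33) FORM: the scale-1 term at the displaced background minus at the background; created with last
coupling `g 1`, depending on `g 0` only through the scale-1 term AS A FUNCTION OF `U`), no scale-0 term.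
* §2 `factorises_Ebal_chartReading`: `Ebal` FACTORISES through the truncated full table `truncTable k g H (U′, Y) := truncScale k H U′ Y`
  with the reading `Q (U + 1, 1) − Q (U, 1)` — OFF the background (the chart∕displaced reading);
* §3 **`not_factorises_Ebal_valueReading`**: for `0 < γ` there is NO map `Φ` with
  `Factorises Ebal (Window γ) truncTable (fun k s Q U X => Φ k s (fun Y => Q (U, Y)) U X)` — the reading shape of p218863 §2 ∕
  p220104 §4 (table AT the background): two histories `γ, γ, γ, …` and `γ∕2, γ, γ, …` have the same last coupling at step 1 and the
  same table at `U = 0` (all zero) but different scale-2 terms `γ ≠ γ∕2`;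
* §4 the same NO-GO for every background-BLIND reading (any `Ψ` with `Ψ k s Q U X = Ψ k s Q′ U X` whenever `Q (U, ·) = Q′ (U, ·)`).
CONSEQUENCE (sheet §2, for the substrate typer ∕ NE5-p1 ∕ dagwriter): an O1 instance whose insertion reads `tableB EB g U` cannot be
Bałaban's step beyond the first creation step whatever the displayed letters `iop`; the faithful table is the CHART table — the
earlier family on the complex chart around `U` (request D-8 extended by item (iv): «the insertion∕species channel reads the chart
table»), which is exactly what the NE9 END of record already does (its table = the species channel `cpieceChannel` over the chart
`E`).  DISGUISE TEST: a toy; identities and one `γ ≠ γ∕2`; nothing of NE9's estimate.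

References (TYPES only): [Balaban1988RG2Cluster] T. Bałaban, CMP **116** (1988) 1–22, (1.23) p. 7, Lemma 1 (1.33)–(1.36) p. 9.
Summits-side NEW work (LEAN PLACEMENT RULE); imports `T4HistoryLipschitzOuter` (shape `Factorises`) BY NAME; modifies nothing.
-/

noncomputable section

namespace Summit.QuantumFields.BalabanUV.T4Continuum.NE9TableSlotChartWitness

open Literature.MathematicalPhysics.QuantumFieldTheory.Balaban1983to89
open Literature.MathematicalPhysics.QuantumFieldTheory.Balaban1983to89.T4OutputRate
open Literature.MathematicalPhysics.QuantumFieldTheory.Balaban1983to89.T4HistoryLipschitzRecursion (truncScale)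
open Literature.MathematicalPhysics.QuantumFieldTheory.Balaban1983to89.T4HistoryLipschitzOuter (Factorises)

/-! ## §1 The toy: three creation steps, one real background coordinate, a (1.33)-shaped scale-2 term -/

/-- The toy carriers: domains `0, 1, 2` with creation step = the label, tree length 0, backgrounds `ℝ` (one chart coordinate),
zero gauge, identity transport. [folklore] -/
abbrev toyCarriers : Carriers where
  Dom := Fin 3
  scale := fun X => X.val
  d := fun _ => 0
  d_nonneg := fun _ => le_rfl
  BgA := ℝ
  BgB := ℝ
  gauge := fun _ _ => 0
  gauge_nonneg := fun _ _ => le_rfl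
  transport := id

/-- **THE (1.33)-SHAPED TOY FAMILY**: no scale-0 term; scale-1 term `g 0 · U` (born with last coupling `g 0`); scale-2 term = the
scale-1 term at the DISPLACED background `U + 1` minus at `U` (born with last coupling `g 1`; depends on `g 0` only through the
scale-1 term as a function of the background — the FORM of [II] (1.33) `E_k(U_k(exp iB′)) − E_k(U_k)`).
[cite: Balaban1988RG2Cluster, Lemma 1 (1.33) p.9] -/
def Ebal : Functional toyCarriers ℝ := fun g U X =>
  if X.val = 1 then g 0 * U else if X.val = 2 then g 0 * (U + 1) - g 0 * U else 0

/-- The FULL-table channel of the faces of record (`ι := Bg × Dom`, `fun _ _ H p => H p.1 p.2`), TRUNCATED to the creation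
steps `≤ k` already present at step `k` (so that no reading can copy the new term from the table). [folklore] -/
def truncTable : ℕ → (ℕ → ℝ) → (ℝ → toyCarriers.Dom → ℝ) → ℝ × toyCarriers.Dom → ℝ :=
  fun k _ H p => truncScale (C := toyCarriers) k H p.1 p.2

/-- `Ebal` at the three domains. [folklore] -/
theorem Ebal_zero (g : ℕ → ℝ) (U : ℝ) : Ebal g U 0 = 0 := by simp [Ebal]

/-- `Ebal` at domain 1. [folklore] -/
theorem Ebal_one (g : ℕ → ℝ) (U : ℝ) : Ebal g U 1 = g 0 * U := by simp [Ebal]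

/-- `Ebal` at domain 2 (the displaced difference, `= g 0`). [folklore] -/
theorem Ebal_two (g : ℕ → ℝ) (U : ℝ) : Ebal g U 2 = g 0 * (U + 1) - g 0 * U := by simp [Ebal]

/-- The truncated table at level 1 reads the scale-1 term at ANY background. [folklore] -/
theorem truncTable_one_one (g : ℕ → ℝ) (U' : ℝ) : truncTable 1 g (Ebal g) (U', 1) = g 0 * U' := by
  simp [truncTable, truncScale, Ebal]

/-! ## §2 POSITIVE: the (1.33)-shaped step factorises through the table read OFF the background -/

/-- **THE CHART READING FACTORISES `Ebal`.**  New-term map: at step 0, `s · U`; at step 1, `Q (U + 1, 1) − Q (U, 1)` — the table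
read at the DISPLACED background `U + 1` and at `U`; `Factorises Ebal W truncTable Ψchart` on every window. [cite: Balaban1988RG2Cluster, Lemma 1 (1.33) p.9] -/
theorem factorises_Ebal_chartReading (W : Set (ℕ → ℝ)) :
    Factorises Ebal W truncTable fun k s Q U X =>
      if X.val = 1 then (if k = 0 then s * U else 0) else if X.val = 2 then Q (U + 1, 1) - Q (U, 1) else 0 := by
  intro g _ k U X hX
  have hX3 : X.val < 3 := X.isLt
  change X.val = k + 1 at hX
  dsimp only
  rcases Nat.lt_or_ge X.val 2 with h | h
  · have h1 : X.val = 1 := by omega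
    have hk : k = 0 := by omega
    subst hk
    rw [if_pos h1, if_pos rfl]
    simp [Ebal, h1]
  · have h2 : X.val = 2 := by omega
    have hk : k = 1 := by omega
    subst hk
    rw [if_neg (by omega), if_pos h2, truncTable_one_one, truncTable_one_one]
    simp [Ebal, h2]

/-! ## §3 NEGATIVE: no reading of the table AT the background factorises `Ebal` (the reading shape of p218863 §2 ∕ p220104 §4) -/

/-- The two test histories: `γ, γ, γ, …` and `γ∕2, γ, γ, …` — same last coupling at step 1, different `g 0`. [folklore] -/
theorem mem_window_const {γ : ℝ} (hγ : 0 < γ) : (fun _ : ℕ => γ) ∈ Window γ := fun _ => ⟨hγ, le_rfl⟩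

/-- The second test history lies in the window. [folklore] -/
theorem mem_window_half {γ : ℝ} (hγ : 0 < γ) : (fun i : ℕ => if i = 0 then γ / 2 else γ) ∈ Window γ := by
  intro i
  by_cases h : i = 0
  · subst h; simp only [if_true]; constructor <;> linarith
  · simp only [h, if_false]; exact ⟨hγ, le_rfl⟩

/-- At the background `U = 0` the level-1 truncated tables of ALL histories COINCIDE (all entries vanish: no scale-0 term, the
scale-1 term `g 0 · 0 = 0`, scale 2 truncated). [folklore] -/
theorem truncTable_one_at_zero (g : ℕ → ℝ) (Y : toyCarriers.Dom) : truncTable 1 g (Ebal g) (0, Y) = 0 := by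
  have hY : Y.val < 3 := Y.isLt
  simp only [truncTable, truncScale, Ebal, mul_zero, zero_add, mul_one, sub_zero]
  split_ifs <;> first | rfl | omega

/-- The scale-2 terms of the two test histories at `U = 0`: `γ` and `γ∕2`. [folklore] -/
theorem Ebal_two_tests (γ : ℝ) :
    Ebal (fun _ : ℕ => γ) 0 2 = γ ∧ Ebal (fun i : ℕ => if i = 0 then γ / 2 else γ) 0 2 = γ / 2 := by
  constructor <;> simp [Ebal]

/-- **NO VALUE-TABLE READING FACTORISES `Ebal` (kernel no-go, OBJ-NE9-g31-1).**  For `0 < γ` there is NO `Φ` (any function of the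
step, the last coupling, the table AT the background, the background and the domain) with
`Factorises Ebal (Window γ) truncTable (fun k s Q U X => Φ k s (fun Y => Q (U, Y)) U X)`: at `U = 0`, step 1, the two test
histories present the same last coupling `γ` and the same table (zero) but have scale-2 terms `γ ≠ γ∕2`.  This is the reading
shape `fun Y => Q (U, Y)` of the faces of record p218863 §2 ∕ p220104 §4 (there legitimately: they describe the substrate's
`insB g U k (tableB EB g U)`, which IS background-blind) — so that step cannot be a (1.33)-shaped step.
[cite: Balaban1988RG2Cluster, (1.23) p.7, Lemma 1 (1.33) p.9] -/
theorem not_factorises_Ebal_valueReading {γ : ℝ} (hγ : 0 < γ) :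
    ¬ ∃ Φ : ℕ → ℝ → (toyCarriers.Dom → ℝ) → ℝ → toyCarriers.Dom → ℝ,
      Factorises Ebal (Window γ) truncTable fun k s Q U X => Φ k s (fun Y => Q (U, Y)) U X := by
  rintro ⟨Φ, hΦ⟩
  have h1 := hΦ _ (mem_window_const hγ) 1 0 2 rfl
  have h2 := hΦ _ (mem_window_half hγ) 1 0 2 rfl
  dsimp only at h1 h2
  rw [(Ebal_two_tests γ).1] at h1
  rw [(Ebal_two_tests γ).2, if_neg one_ne_zero] at h2
  have key : Φ 1 γ (fun Y => truncTable 1 (fun _ : ℕ => γ) (Ebal fun _ => γ) (0, Y)) 0 2 =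
      Φ 1 γ (fun Y => truncTable 1 (fun i : ℕ => if i = 0 then γ / 2 else γ)
        (Ebal fun i => if i = 0 then γ / 2 else γ) (0, Y)) 0 2 := by
    congr 1; funext Y; rw [truncTable_one_at_zero, truncTable_one_at_zero]
  have : γ = γ / 2 := h1.trans (key.trans h2.symm)
  linarith

/-! ## §4 The same for every background-BLIND reading -/

/-- **NO BACKGROUND-BLIND READING FACTORISES `Ebal`.**  Any new-term map `Ψ` that cannot distinguish two tables agreeing AT the
background (`Q (U, ·) = Q′ (U, ·) → Ψ k s Q U X = Ψ k s Q′ U X`) fails to factorise `Ebal` on `Window γ`, `0 < γ`.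
[cite: Balaban1988RG2Cluster, Lemma 1 (1.33) p.9] -/
theorem not_factorises_Ebal_blind {γ : ℝ} (hγ : 0 < γ)
    (Ψ : ℕ → ℝ → (ℝ × toyCarriers.Dom → ℝ) → ℝ → toyCarriers.Dom → ℝ)
    (hblind : ∀ k s Q Q' U X, (∀ Y, Q (U, Y) = Q' (U, Y)) → Ψ k s Q U X = Ψ k s Q' U X) :
    ¬ Factorises Ebal (Window γ) truncTable Ψ := by
  intro hΨ
  have h1 := hΨ _ (mem_window_const hγ) 1 0 2 rfl
  have h2 := hΨ _ (mem_window_half hγ) 1 0 2 rfl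
  rw [(Ebal_two_tests γ).1] at h1
  rw [(Ebal_two_tests γ).2, if_neg one_ne_zero] at h2
  have key := hblind 1 γ (truncTable 1 (fun _ : ℕ => γ) (Ebal fun _ => γ))
    (truncTable 1 (fun i : ℕ => if i = 0 then γ / 2 else γ) (Ebal fun i => if i = 0 then γ / 2 else γ)) 0 2
    (fun Y => by rw [truncTable_one_at_zero, truncTable_one_at_zero])
  have : γ = γ / 2 := h1.trans (key.trans h2.symm)
  linarith

/-- SANITY: the chart reading of §2 is NOT background-blind (it reads the table at `U + 1`). [folklore] -/
theorem chartReading_not_blind :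
    ¬ ∀ (Q Q' : ℝ × toyCarriers.Dom → ℝ) (U : ℝ), (∀ Y, Q (U, Y) = Q' (U, Y)) →
      (Q (U + 1, 1) - Q (U, 1)) = (Q' (U + 1, 1) - Q' (U, 1)) := by
  intro h
  have := h (fun p => p.1) (fun _ => 0) 0 (fun Y => by simp)
  norm_num at this

end Summit.QuantumFields.BalabanUV.T4Continuum.NE9TableSlotChartWitness

end
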